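import Literature.Geometry.Riemannian.PinchingEstimatesConstraints
import Literature.Geometry.Riemannian.PinchingEstimates
import Literature.Geometry.Riemannian.RicciFlowScalarCurvatureProofs
import Literature.Geometry.Riemannian.RiemannianDistance
import Literature.Geometry.Riemannian.OrthonormalFrameBounds
import Literature.Geometry.Riemannian.SurgicalSolutions
import HarnessLib

/-!
# Pinched curvature is controlled by the scalar curvature (Chen–Zhu 2006, §§4–5)
(topic `Geometry/Riemannian`)

A step of the surgery construction behind
`Literature.Geometry.Riemannian.chenZhu_ricciFlowWithSurgery` (B.-L. Chen, X.-P. Zhu,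
J. Differential Geom. 74 (2006), arXiv:math/0504478, Thm. 1.1). Under the pinching assumption
(5.1)–(5.2) of the a priori assumptions (§5, p. 26: "`a₁ + ρ > 0`, `c₁ + ρ > 0`,
`max{a₃, b₃, c₃} ≤ Λ(a₁ + ρ)`, `max{a₃, b₃, c₃} ≤ Λ(c₁ + ρ)`", rendered frame-wise as
`Matrix.PinchedBy A B C ρ Λ` on Hamilton's blocks `(A, B, C)` of the curvature operator,
`PinchingEstimates.lean`) **bounded scalar curvature means bounded curvature**: this is how
"the curvature" and "the scalar curvature" are used interchangeably in §4 (p. 24: "`Ω` denote[s]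
the set of all points in `M`, where curvature stays bounded … `R(x,t) → +∞`") and in every
rescaling argument of §§4–5 (Thm. 4.1, Lemma 5.2, Prop. 5.4), and it is what lets the local
derivative estimates (curvature hypotheses) act on `Ω = {R bounded}`
(`SingularTimeBoundedSet.lean`). In Hamilton's words (1997, §2, after Cor. 1.8): all curvature
quantities are bounded by multiples of `a₁ + ρ` and `c₁ + ρ`. Everything here is proved; the
definitions are explicit linear algebra (no `Prop`-valued facts):

* `hamiltonSignMatrix` (`Q`, the coefficients of `φᵢ, ψᵢ` in the coordinate 2-vectors
  `ω = (X₁∧X₂, X₃∧X₄, X₁∧X₃, X₄∧X₂, X₁∧X₄, X₂∧X₃)`; `ᵗQ Q = 2`), `basicPairs` (`ω`),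
  `basicCurvatureMatrix` (`Rω_{kl} = R(ω_k, ω_l)`), `hamiltonLists`, `blockSix`
  (Hamilton's `M = (A B; B' C)` as one `6 × 6` matrix), `plueckerCoords`;
* `Matrix.PinchedBy.abs_apply_le` — for a pinched triple with `A, C` symmetric and
  `tr A ≤ K/2`, all entries of `A, B, C` are at most `2 (Λ (K/6 + ρ) + ρ)` in absolute value
  (some `Aᵢᵢ ≤ tr A/3` serves as `w`; polarisation for off-diagonal entries);
* `blockSix_eq_mul` (`M = Q Rω ᵗQ`, the 36 bilinear expansions, using antisymmetry of `Rm` in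
  both pairs), `basicCurvatureMatrix_eq_smul` (`Rω = ¼ ᵗQ M Q`),
  `abs_basicCurvatureMatrix_le` (`|R(ω_k, ω_l)| ≤ max |M|`), `abs_blockSix_le`;
* `trace_blockA_add_trace_blockC` (`tr A + tr C = R` in an orthonormal basis),
  `trace_blockA_eq_half_scalarCurvature` (`tr A = R/2`, with the Bianchi identity
  `tr A = tr C` of `PinchingEstimatesConstraints.lean`; Chen–Zhu p. 4: "`tr A = tr C = ½R`");
* `curvatureForm_eq_sum_sum_basicCurvatureMatrix` —
  `Rm(X,Y,Z,W) = Σ_{k,l} p_k(X,Y) q_l(W,Z) R(ω_k, ω_l)` (Plücker expansion),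
  `abs_curvatureForm_le_of_abs_basicCurvatureMatrix_le` (`|Rm| ≤ 144 max |Rω|` on
  coordinate-bounded vectors), `abs_repr_le_one_of_isOrthonormalFrame`;
* **`abs_curvatureForm_le_of_pinchedBy`** — on a Riemannian 4-manifold with a Levi-Civita
  connection, pinching in every orthonormal frame at `x` and `R(x) ≤ K` give
  `|Rm_x(X,Y,Z,W)| ≤ 288 (Λ (K/6 + ρ) + ρ)` on `g`-unit-bounded vectors;
  `curvatureBoundedOn_setOf_scalarCurvature_le_of_pinchedBy` (`CurvatureBoundedOn` on
  `{R ≤ K}`); for stages of a surgical solution, `ChenZhuAPriori.abs_curvatureForm_le` and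
  `ChenZhuAPriori.curvatureBoundedOn_setOf_scalarCurvature_le`.

## References

* B.-L. Chen, X.-P. Zhu, *Ricci flow with surgery on four-manifolds with positive isotropic
  curvature*, J. Differential Geom. 74 (2006) 177–264 (arXiv:math/0504478): §2, p. 4
  (`tr A = tr C = ½R`); Thm. 4.1 (p. 19); §4, p. 24; §5, p. 26, (5.1)–(5.2). [ChenZhu2006]
* R. S. Hamilton, *Four-manifolds with positive isotropic curvature*, Comm. Anal. Geom. 5 (1997)
  1–92, §1.2 (pp. 4–5: `M = (A B; ᵗB C)`, the bases `φᵢ`, `ψᵢ`), §2, Cors. 1.5, 1.8.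
  [Hamilton1997]
* R. S. Hamilton, *Four-manifolds with positive curvature operator*, J. Differential Geom. 24
  (1986) 153–179, §6 (the block decomposition). [Hamilton1986]
-/

noncomputable section

open Bundle Set Function Finset Matrix
open scoped Manifold ContDiff Topology BigOperators

namespace Literature.Geometry.Riemannian

open Lorentzian Lorentzian.PseudoRiemannianMetric

/-! ### Hamilton's sign matrix -/

/-- **Hamilton's sign matrix** `Q`: the rows are the coefficient vectors of
`φ₁, φ₂, φ₃, ψ₁, ψ₂, ψ₃` (Hamilton 1997, p. 5: `φ₁ = X₁∧X₂ + X₃∧X₄`, …, `ψ₃ = X₁∧X₄ − X₂∧X₃`) in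
the six coordinate 2-vectors `ω = (X₁∧X₂, X₃∧X₄, X₁∧X₃, X₄∧X₂, X₁∧X₄, X₂∧X₃)`; `Q/√2` is
orthogonal. [cite: Hamilton1997, §1.2, p. 5] -/
def hamiltonSignMatrix : Matrix (Fin 6) (Fin 6) ℝ :=
  !![1, 1, 0, 0, 0, 0;
     0, 0, 1, 1, 0, 0;
     0, 0, 0, 0, 1, 1;
     1, -1, 0, 0, 0, 0;
     0, 0, 1, -1, 0, 0;
     0, 0, 0, 0, 1, -1]

/-- `ᵗQ Q = 2`. [cite: Hamilton1997, §1.2, p. 5] -/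
theorem hamiltonSignMatrix_transpose_mul_self :
    hamiltonSignMatrixᵀ * hamiltonSignMatrix = (2 : ℝ) • (1 : Matrix (Fin 6) (Fin 6) ℝ) := by
  ext i j
  fin_cases i <;> fin_cases j <;>
    simp [hamiltonSignMatrix, Matrix.mul_apply, Fin.sum_univ_six] <;> norm_num

/-- Every column of `Q` has absolute sum `2`. [folklore] -/
theorem sum_abs_hamiltonSignMatrix (k : Fin 6) : ∑ i, |hamiltonSignMatrix i k| = 2 := by
  fin_cases k <;> simp [hamiltonSignMatrix, Fin.sum_univ_six] <;> norm_num

/-- **Entries of `ᵗQ S Q / 4` are bounded by the entries of `S`**: if `|S i j| ≤ μ` for all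
`i, j`, then `|(ᵗQ S Q) k l| ≤ 4 μ` (each column of `Q` has absolute sum `2`). [folklore] -/
theorem abs_transpose_mul_mul_hamiltonSignMatrix_le {S : Matrix (Fin 6) (Fin 6) ℝ} {μ : ℝ}
    (hS : ∀ i j, |S i j| ≤ μ) (k l : Fin 6) :
    |(hamiltonSignMatrixᵀ * S * hamiltonSignMatrix) k l| ≤ 4 * μ := by
  set Q := hamiltonSignMatrix with hQ
  have hμ : 0 ≤ μ := (abs_nonneg _).trans (hS 0 0)
  have hentry : (Qᵀ * S * Q) k l = ∑ j, (∑ i, Q i k * S i j) * Q j l := by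
    simp only [Matrix.mul_apply, Matrix.transpose_apply]
  rw [hentry]
  calc |∑ j, (∑ i, Q i k * S i j) * Q j l|
      ≤ ∑ j, |(∑ i, Q i k * S i j) * Q j l| := Finset.abs_sum_le_sum_abs _ _
    _ ≤ ∑ j, (∑ i, |Q i k| * μ) * |Q j l| := by
        refine Finset.sum_le_sum fun j _ ↦ ?_
        rw [abs_mul]
        refine mul_le_mul_of_nonneg_right ?_ (abs_nonneg _)
        refine (Finset.abs_sum_le_sum_abs _ _).trans (Finset.sum_le_sum fun i _ ↦ ?_)
        rw [abs_mul]
        exact mul_le_mul_of_nonneg_left (hS i j) (abs_nonneg _)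
    _ = μ * (∑ i, |Q i k|) * (∑ j, |Q j l|) := by
        rw [Finset.mul_sum]
        refine Finset.sum_congr rfl fun j _ ↦ ?_
        rw [← Finset.sum_mul]
        ring
    _ = 4 * μ := by
        rw [hQ, sum_abs_hamiltonSignMatrix k, sum_abs_hamiltonSignMatrix l]
        ring

/-! ### Entry bounds for pinched block triples -/

section Blocks

variable {A B C : Matrix (Fin 3) (Fin 3) ℝ} {ρ Λ : ℝ}

/-- `eᵢ ⬝ eᵢ = 1`. [folklore] -/
theorem single_dotProduct_single_self (i : Fin 3) :
    (Pi.single i (1 : ℝ)) ⬝ᵥ (Pi.single i 1) = 1 := by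
  simp

/-- `eᵢ ⬝ (X eⱼ) = Xᵢⱼ`. [folklore] -/
theorem single_dotProduct_mulVec_single (X : Matrix (Fin 3) (Fin 3) ℝ) (i j : Fin 3) :
    (Pi.single i (1 : ℝ)) ⬝ᵥ (X *ᵥ Pi.single j 1) = X i j := by
  simp [Matrix.mulVec, dotProduct, Pi.single_apply]

/-- The unit vector `(eᵢ + eⱼ)/√2`, `i ≠ j`. [folklore] -/
theorem diag_dotProduct_self {i j : Fin 3} (hij : i ≠ j) :
    ((Real.sqrt 2)⁻¹ • (Pi.single i 1 + Pi.single j 1 : Fin 3 → ℝ)) ⬝ᵥ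
      ((Real.sqrt 2)⁻¹ • (Pi.single i 1 + Pi.single j 1 : Fin 3 → ℝ)) = 1 := by
  simp only [smul_dotProduct, dotProduct_smul, add_dotProduct, dotProduct_add, smul_eq_mul]
  have hij1 : (Pi.single i (1 : ℝ) : Fin 3 → ℝ) ⬝ᵥ (Pi.single j 1) = 0 := by simp [hij]
  have hij2 : (Pi.single j (1 : ℝ) : Fin 3 → ℝ) ⬝ᵥ (Pi.single i 1) = 0 := by simp [hij.symm]
  rw [single_dotProduct_single_self, single_dotProduct_single_self, hij1, hij2]
  have : (Real.sqrt 2)⁻¹ * (Real.sqrt 2)⁻¹ = 2⁻¹ := by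
    rw [← mul_inv, Real.mul_self_sqrt (by norm_num : (0:ℝ) ≤ 2)]
  linear_combination (2 : ℝ) * this

/-- The quadratic value of `X` on `(eᵢ + eⱼ)/√2` is `(Xᵢᵢ + Xᵢⱼ + Xⱼᵢ + Xⱼⱼ)/2`. [folklore] -/
theorem diag_dotProduct_mulVec_diag (X : Matrix (Fin 3) (Fin 3) ℝ) (i j : Fin 3) :
    ((Real.sqrt 2)⁻¹ • (Pi.single i 1 + Pi.single j 1 : Fin 3 → ℝ)) ⬝ᵥ
      (X *ᵥ ((Real.sqrt 2)⁻¹ • (Pi.single i 1 + Pi.single j 1 : Fin 3 → ℝ))) =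
        (X i i + X i j + X j i + X j j) / 2 := by
  simp only [smul_dotProduct, Matrix.mulVec_smul, dotProduct_smul, add_dotProduct,
    Matrix.mulVec_add, dotProduct_add, smul_eq_mul, single_dotProduct_mulVec_single]
  have : (Real.sqrt 2)⁻¹ * (Real.sqrt 2)⁻¹ = 2⁻¹ := by
    rw [← mul_inv, Real.mul_self_sqrt (by norm_num : (0:ℝ) ≤ 2)]
  linear_combination (X i i + X i j + X j i + X j j) * this

/-- **Entry bounds for a pinched block triple** (the read-out of Chen–Zhu's (5.1)–(5.2) /
Hamilton's Cors. 1.5, 1.8): if `(A, B, C)` satisfies `Matrix.PinchedBy A B C ρ Λ` (`ρ, Λ ≥ 0`)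
with `A`, `C` symmetric and `tr A ≤ K/2`, then with `Θ = Λ (K/6 + ρ)` every entry of `A`, `B`
and `C` is at most `2 (Θ + ρ)` in absolute value: some diagonal entry `Aᵢᵢ ≤ tr A / 3 ≤ K/6`
serves as `w` in the pinching inequalities, giving `−ρ < uAu ≤ Θ`, `|uBv| ≤ Θ`, `−ρ < uCu ≤ Θ`
for unit `u, v`; off-diagonal entries by polarisation on `(eᵢ + eⱼ)/√2`.
[cite: ChenZhu2006, §5, p. 26, (5.1)–(5.2)] [cite: Hamilton1997, §2, Cor. 1.5 and Cor. 1.8] -/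
theorem _root_.Matrix.PinchedBy.abs_apply_le (hP : Matrix.PinchedBy A B C ρ Λ) (hρ : 0 ≤ ρ) (hΛ : 0 ≤ Λ)
    (hA : A.IsSymm) (hC : C.IsSymm) {K : ℝ} (hK : A.trace ≤ K / 2) (i j : Fin 3) :
    |A i j| ≤ 2 * (Λ * (K / 6 + ρ) + ρ) ∧ |B i j| ≤ 2 * (Λ * (K / 6 + ρ) + ρ) ∧
      |C i j| ≤ 2 * (Λ * (K / 6 + ρ) + ρ) := by
  -- a small diagonal entry of `A`
  obtain ⟨i₀, -, hi₀⟩ : ∃ i₀ ∈ (Finset.univ : Finset (Fin 3)), A i₀ i₀ ≤ K / 6 := by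
    refine Finset.exists_le_of_sum_le Finset.univ_nonempty ?_
    have htr : ∑ i, A i i = A.trace := rfl
    rw [htr]
    simp only [Finset.sum_const, Finset.card_univ, Fintype.card_fin, nsmul_eq_mul, Nat.cast_ofNat]
    linarith
  set w₀ : Fin 3 → ℝ := Pi.single i₀ 1 with hw₀
  have hw₀u : w₀ ⬝ᵥ w₀ = 1 := single_dotProduct_single_self i₀
  have hw₀A : w₀ ⬝ᵥ (A *ᵥ w₀) = A i₀ i₀ := single_dotProduct_mulVec_single A i₀ i₀
  set Θ : ℝ := Λ * (K / 6 + ρ) with hΘ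
  have hm₀ : 0 < A i₀ i₀ + ρ := by
    have := (hP.1 w₀ hw₀u).1
    rwa [hw₀A] at this
  have hΛm₀ : Λ * (A i₀ i₀ + ρ) ≤ Θ := by
    rw [hΘ]
    exact mul_le_mul_of_nonneg_left (by linarith) hΛ
  have hΛm : Λ * (w₀ ⬝ᵥ (A *ᵥ w₀) + ρ) ≤ Θ := by rwa [hw₀A]
  have hΘ0 : 0 ≤ Θ := le_trans (mul_nonneg hΛ hm₀.le) hΛm₀
  -- quadratic bounds for unit vectors
  have hquad : ∀ u v : Fin 3 → ℝ, u ⬝ᵥ u = 1 → v ⬝ᵥ v = 1 →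
      (-ρ < u ⬝ᵥ (A *ᵥ u) ∧ u ⬝ᵥ (A *ᵥ u) ≤ Θ) ∧ |u ⬝ᵥ (B *ᵥ v)| ≤ Θ ∧
        (-ρ < u ⬝ᵥ (C *ᵥ u) ∧ u ⬝ᵥ (C *ᵥ u) ≤ Θ) := by
    intro u v hu hv
    have h1 := hP.1 u hu
    have h2 := (hP.2 u v w₀ hu hv hw₀u).1
    have hnv : (-v) ⬝ᵥ (-v) = 1 := by simpa using hv
    have h3 := (hP.2 u (-v) w₀ hu hnv hw₀u).1
    have hBneg : u ⬝ᵥ (B *ᵥ (-v)) = -(u ⬝ᵥ (B *ᵥ v)) := by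
      rw [Matrix.mulVec_neg, dotProduct_neg]
    refine ⟨⟨by linarith [h1.1], h2.1.trans hΛm⟩, ?_, ⟨by linarith [h1.2], h2.2.2.trans hΛm⟩⟩
    rw [abs_le]
    constructor
    · have := h3.2.1
      rw [hBneg] at this
      linarith
    · exact h2.2.1.trans hΛm
  -- diagonal entries
  have hdiagA : ∀ i, |A i i| ≤ Θ + ρ := by
    intro i
    have h := (hquad _ _ (single_dotProduct_single_self i) (single_dotProduct_single_self i)).1
    rw [single_dotProduct_mulVec_single] at h
    rw [abs_le]; constructor <;> linarith
  have hdiagC : ∀ i, |C i i| ≤ Θ + ρ := by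
    intro i
    have h := (hquad _ _ (single_dotProduct_single_self i) (single_dotProduct_single_self i)).2.2
    rw [single_dotProduct_mulVec_single] at h
    rw [abs_le]; constructor <;> linarith
  have hB : ∀ i j, |B i j| ≤ Θ := by
    intro i j
    have h := (hquad _ _ (single_dotProduct_single_self i) (single_dotProduct_single_self j)).2.1
    rwa [single_dotProduct_mulVec_single] at h
  -- off-diagonal entries of a symmetric matrix with these quadratic bounds
  have hoff : ∀ (X : Matrix (Fin 3) (Fin 3) ℝ), X.IsSymm → (∀ i, |X i i| ≤ Θ + ρ) →
      (∀ u : Fin 3 → ℝ, u ⬝ᵥ u = 1 → -ρ < u ⬝ᵥ (X *ᵥ u) ∧ u ⬝ᵥ (X *ᵥ u) ≤ Θ) →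
      ∀ i j, |X i j| ≤ 2 * (Θ + ρ) := by
    intro X hX hdiag hq i j
    rcases eq_or_ne i j with rfl | hij
    · linarith [hdiag i, abs_nonneg (X i i)]
    have hu := diag_dotProduct_self hij
    have hq' := hq _ hu
    rw [diag_dotProduct_mulVec_diag] at hq'
    have hji : X j i = X i j := by
      have := congrFun (congrFun hX i) j
      simpa [Matrix.transpose_apply] using this
    rw [hji] at hq'
    have hi := hdiag i
    have hj := hdiag j
    rw [abs_le] at hi hj ⊢
    constructor <;> nlinarith [hq'.1, hq'.2, hi.1, hi.2, hj.1, hj.2]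
  have hqA : ∀ u : Fin 3 → ℝ, u ⬝ᵥ u = 1 → -ρ < u ⬝ᵥ (A *ᵥ u) ∧ u ⬝ᵥ (A *ᵥ u) ≤ Θ :=
    fun u hu ↦ (hquad u u hu hu).1
  have hqC : ∀ u : Fin 3 → ℝ, u ⬝ᵥ u = 1 → -ρ < u ⬝ᵥ (C *ᵥ u) ∧ u ⬝ᵥ (C *ᵥ u) ≤ Θ :=
    fun u hu ↦ (hquad u u hu hu).2.2
  refine ⟨hoff A hA hdiagA hqA i j, (hB i j).trans (by linarith), hoff C hC hdiagC hqC i j⟩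

end Blocks


/-! ### The six coordinate 2-vectors of a 4-frame and Hamilton's `6 × 6` block matrix -/

section Frame

variable {E : Type*} [NormedAddCommGroup E] [NormedSpace ℝ E] {H : Type*} [TopologicalSpace H]
  {I : ModelWithCorners ℝ E H} {M : Type*} [TopologicalSpace M] [ChartedSpace H M]
  [IsManifold I ∞ M] {n : ℕ∞ω} [FiniteDimensional ℝ E] [CompleteSpace E]
  (g : PseudoRiemannianMetric I n E (TangentSpace I : M → Type _))
  (cov : CovariantDerivative I E (TangentSpace I : M → Type _)) (x : M)

/-- **The six coordinate 2-vectors `ω` of a 4-frame `e`**, as pairs, in Hamilton's order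
`X₁∧X₂, X₃∧X₄, X₁∧X₃, X₄∧X₂, X₁∧X₄, X₂∧X₃` (1997, p. 5), so that `φᵢ = ω_{2i-1} + ω_{2i}` and
`ψᵢ = ω_{2i-1} − ω_{2i}`. [cite: Hamilton1997, §1.2, p. 5] -/
def basicPairs {V : Type*} (e : Fin 4 → V) : Fin 6 → V × V :=
  ![(e 0, e 1), (e 2, e 3), (e 0, e 2), (e 3, e 1), (e 0, e 3), (e 1, e 2)]

/-- **The curvature pairing on the coordinate 2-vectors**: `Rω_{kl} = R(ω_k, ω_l)`
(`bivectorCurvature`, `R(X∧Y, Z∧W) = Rm(X,Y,W,Z)`). [cite: Hamilton1997, §1.2, pp. 4–5] -/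
def _root_.Literature.Geometry.Lorentzian.PseudoRiemannianMetric.basicCurvatureMatrix
    (e : Fin 4 → TangentSpace I x) : Matrix (Fin 6) (Fin 6) ℝ :=
  Matrix.of fun k l ↦ g.bivectorCurvature cov x (basicPairs e k).1 (basicPairs e k).2
    (basicPairs e l).1 (basicPairs e l).2

/-- Hamilton's six 2-vectors `φ₁, φ₂, φ₃, ψ₁, ψ₂, ψ₃` of a 4-frame, as lists of pairs
(`selfDualPairs`, `antiSelfDualPairs` of `CurvatureDecomposition.lean`). [cite: Hamilton1997, §1.2, p. 5] -/
def hamiltonLists {x : M} (e : Fin 4 → TangentSpace I x) :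
    Fin 6 → Fin 2 → TangentSpace I x × TangentSpace I x :=
  ![selfDualPairs e 0, selfDualPairs e 1, selfDualPairs e 2, antiSelfDualPairs e 0,
    antiSelfDualPairs e 1, antiSelfDualPairs e 2]

/-- **Hamilton's `6 × 6` matrix `M = (A B; B' C)`** of the curvature pairing on
`φ₁, φ₂, φ₃, ψ₁, ψ₂, ψ₃` (1997, p. 4: "a matrix `M_{αβ}` … block decomposition
`M = (A B; ᵗB C)`"; here `B'_{ij} = R(ψᵢ, φⱼ)`, which is `ᵗB` by pair symmetry).
[cite: Hamilton1997, §1.2, p. 4] -/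
def _root_.Literature.Geometry.Lorentzian.PseudoRiemannianMetric.blockSix
    (e : Fin 4 → TangentSpace I x) : Matrix (Fin 6) (Fin 6) ℝ :=
  Matrix.of fun i j ↦ g.pairingCurvature cov x (hamiltonLists e i) (hamiltonLists e j)

variable (e : Fin 4 → TangentSpace I x)

variable {g cov}

/-- **The entries of `M` are the entries of `A`, `B`, `ᵗB`, `C`**: bounds on the entries of
the three blocks bound all entries of `M` (the lower left block is `ᵗB` by the pair symmetry
`R(ψᵢ, φⱼ) = R(φⱼ, ψᵢ)` of a Levi-Civita connection). [cite: Hamilton1997, §1.2, p. 4] -/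
theorem abs_blockSix_le (h : g.IsLeviCivita cov) (hn : 2 ≤ n) {μ : ℝ}
    (hA : ∀ a b, |g.blockA cov x e a b| ≤ μ) (hB : ∀ a b, |g.blockB cov x e a b| ≤ μ)
    (hC : ∀ a b, |g.blockC cov x e a b| ≤ μ) (i j : Fin 6) : |g.blockSix cov x e i j| ≤ μ := by
  have hsymm : ∀ (p q : Fin 2 → TangentSpace I x × TangentSpace I x),
      g.pairingCurvature cov x p q = g.pairingCurvature cov x q p := by
    intro p q
    simp only [pairingCurvature]
    rw [Finset.sum_comm]
    exact Finset.sum_congr rfl fun a _ ↦ Finset.sum_congr rfl fun b _ ↦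
      bivectorCurvature_symm h hn x _ _ _ _
  have hA' : ∀ a b, |g.pairingCurvature cov x (selfDualPairs e a) (selfDualPairs e b)| ≤ μ := hA
  have hB' : ∀ a b, |g.pairingCurvature cov x (selfDualPairs e a) (antiSelfDualPairs e b)| ≤ μ :=
    hB
  have hC' : ∀ a b,
      |g.pairingCurvature cov x (antiSelfDualPairs e a) (antiSelfDualPairs e b)| ≤ μ := hC
  have hBt' : ∀ a b,
      |g.pairingCurvature cov x (antiSelfDualPairs e a) (selfDualPairs e b)| ≤ μ := by
    intro a b; rw [hsymm]; exact hB' b a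
  fin_cases i <;> fin_cases j
  · exact hA' 0 0
  · exact hA' 0 1
  · exact hA' 0 2
  · exact hB' 0 0
  · exact hB' 0 1
  · exact hB' 0 2
  · exact hA' 1 0
  · exact hA' 1 1
  · exact hA' 1 2
  · exact hB' 1 0
  · exact hB' 1 1
  · exact hB' 1 2
  · exact hA' 2 0
  · exact hA' 2 1
  · exact hA' 2 2
  · exact hB' 2 0
  · exact hB' 2 1
  · exact hB' 2 2
  · exact hBt' 0 0
  · exact hBt' 0 1
  · exact hBt' 0 2
  · exact hC' 0 0
  · exact hC' 0 1
  · exact hC' 0 2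
  · exact hBt' 1 0
  · exact hBt' 1 1
  · exact hBt' 1 2
  · exact hC' 1 0
  · exact hC' 1 1
  · exact hC' 1 2
  · exact hBt' 2 0
  · exact hBt' 2 1
  · exact hBt' 2 2
  · exact hC' 2 0
  · exact hC' 2 1
  · exact hC' 2 2

set_option maxHeartbeats 4000000 in
/-- **`M = Q · Rω · ᵗQ`**: the pairings of `φᵢ = ω + ω'`, `ψᵢ = ω − ω'` expand bilinearly in
the pairings of the coordinate 2-vectors (the minus signs of the `ψ`'s being realised in
`antiSelfDualPairs` by swapped pairs, `X₄∧X₃ = −X₃∧X₄`, this uses the antisymmetry of `Rm` in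
its first pair and — for a Levi-Civita connection — in its second pair).
[cite: Hamilton1997, §1.2, pp. 4–5] -/
theorem blockSix_eq_mul (h : g.IsLeviCivita cov) (hn : 2 ≤ n) :
    g.blockSix cov x e =
      hamiltonSignMatrix * g.basicCurvatureMatrix cov x e * hamiltonSignMatrixᵀ := by
  -- normal forms: first pair in the orientation of `ω`, second pair reversed
  have A32 : ∀ Z W, g.curvatureForm cov x (e 3) (e 2) Z W = -g.curvatureForm cov x (e 2) (e 3) Z W :=
    fun Z W ↦ g.curvatureForm_antisymm cov x _ _ _ _
  have A13 : ∀ Z W, g.curvatureForm cov x (e 1) (e 3) Z W = -g.curvatureForm cov x (e 3) (e 1) Z W :=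
    fun Z W ↦ g.curvatureForm_antisymm cov x _ _ _ _
  have A21 : ∀ Z W, g.curvatureForm cov x (e 2) (e 1) Z W = -g.curvatureForm cov x (e 1) (e 2) Z W :=
    fun Z W ↦ g.curvatureForm_antisymm cov x _ _ _ _
  have S23 : ∀ X Y, g.curvatureForm cov x X Y (e 2) (e 3) = -g.curvatureForm cov x X Y (e 3) (e 2) :=
    fun X Y ↦ h.val_curvature_skew hn x _ _ _ _
  have S31 : ∀ X Y, g.curvatureForm cov x X Y (e 3) (e 1) = -g.curvatureForm cov x X Y (e 1) (e 3) :=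
    fun X Y ↦ h.val_curvature_skew hn x _ _ _ _
  have S12 : ∀ X Y, g.curvatureForm cov x X Y (e 1) (e 2) = -g.curvatureForm cov x X Y (e 2) (e 1) :=
    fun X Y ↦ h.val_curvature_skew hn x _ _ _ _
  have f2 : ∀ hk, (⟨2, hk⟩ : Fin 6) = 2 := fun _ ↦ rfl
  have f3 : ∀ hk, (⟨3, hk⟩ : Fin 6) = 3 := fun _ ↦ rfl
  have f4 : ∀ hk, (⟨4, hk⟩ : Fin 6) = 4 := fun _ ↦ rfl
  have f5 : ∀ hk, (⟨5, hk⟩ : Fin 6) = 5 := fun _ ↦ rfl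
  ext i j
  fin_cases i <;> fin_cases j <;>
    simp only [Fin.zero_eta, Fin.mk_one, f2, f3, f4, f5] <;>
    simp only [blockSix, hamiltonLists, basicCurvatureMatrix, basicPairs, hamiltonSignMatrix,
      pairingCurvature, selfDualPairs, antiSelfDualPairs, bivectorCurvature, Fin.sum_univ_two,
      Fin.sum_univ_six, Matrix.mul_apply, Matrix.of_apply, Matrix.transpose_apply,
      Matrix.cons_val', Matrix.cons_val_zero, Matrix.cons_val_one, Matrix.cons_val_fin_one,
      Matrix.empty_val', Matrix.cons_val, Fin.isValue] <;>
    (try simp only [A32, A13, A21, S23, S31, S12]) <;> ring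

/-- **`Rω = ¼ ᵗQ M Q`** (from `M = Q Rω ᵗQ` and `ᵗQ Q = 2`). [cite: Hamilton1997, §1.2, pp. 4–5] -/
theorem basicCurvatureMatrix_eq_smul (h : g.IsLeviCivita cov) (hn : 2 ≤ n) :
    g.basicCurvatureMatrix cov x e =
      (4 : ℝ)⁻¹ • (hamiltonSignMatrixᵀ * g.blockSix cov x e * hamiltonSignMatrix) := by
  set Q := hamiltonSignMatrix with hQ
  set R := g.basicCurvatureMatrix cov x e with hR
  have h2 : Qᵀ * Q = (2 : ℝ) • (1 : Matrix (Fin 6) (Fin 6) ℝ) := hamiltonSignMatrix_transpose_mul_self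
  have h4 : Qᵀ * g.blockSix cov x e * Q = (4 : ℝ) • R := by
    rw [blockSix_eq_mul x e h hn]
    calc Qᵀ * (Q * R * Qᵀ) * Q = (Qᵀ * Q) * R * (Qᵀ * Q) := by
          simp only [Matrix.mul_assoc]
      _ = ((2 : ℝ) • 1) * R * ((2 : ℝ) • 1) := by rw [h2]
      _ = (4 : ℝ) • R := by
          simp only [Matrix.smul_mul, Matrix.mul_smul, Matrix.one_mul, Matrix.mul_one, smul_smul]
          norm_num
  rw [h4, smul_smul]
  norm_num

/-- **The coordinate pairings are bounded by the block entries**: if all entries of Hamilton's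
matrix `M = (A B; ᵗB C)` are at most `μ` in absolute value, so are all `R(ω_k, ω_l)`.
[cite: Hamilton1997, §1.2, pp. 4–5] -/
theorem abs_basicCurvatureMatrix_le (h : g.IsLeviCivita cov) (hn : 2 ≤ n) {μ : ℝ}
    (hM : ∀ i j, |g.blockSix cov x e i j| ≤ μ) (k l : Fin 6) :
    |g.basicCurvatureMatrix cov x e k l| ≤ μ := by
  rw [basicCurvatureMatrix_eq_smul x e h hn, Matrix.smul_apply, smul_eq_mul, abs_mul,
    abs_of_pos (by norm_num : (0 : ℝ) < 4⁻¹)]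
  have := abs_transpose_mul_mul_hamiltonSignMatrix_le hM k l
  linarith


/-! ### `tr A + tr C = R` in an orthonormal frame -/

/-- **`tr A + tr C = R`** for the blocks of a Levi-Civita connection in a `g_x`-orthonormal basis:
`Aᵢᵢ + Cᵢᵢ = 2 (K(ω_{2i-1}) + K(ω_{2i}))` and `R = Σ_{a ≠ b} Rm(e_b, e_a, e_a, e_b) = 2 Σ_{a<b} K_{ab}`
(Chen–Zhu 2006, p. 4: "`tr A = tr C = ½ R`"; Hamilton 1986, §6). With `tr A = tr C`
(`trace_blockA_eq_trace_blockC`) this gives `tr A = R/2`.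
[cite: ChenZhu2006, §2, p. 4] [cite: Hamilton1997, §1.2, p. 5] -/
theorem trace_blockA_add_trace_blockC (h : g.IsLeviCivita cov) (hn : 2 ≤ n)
    (b : Module.Basis (Fin 4) ℝ (TangentSpace I x)) (hb : g.IsOrthonormalFrame x b) :
    (g.blockA cov x b).trace + (g.blockC cov x b).trace = g.scalarCurvatureWith cov x := by
  have A10 : ∀ Z W, g.curvatureForm cov x (b 1) (b 0) Z W = -g.curvatureForm cov x (b 0) (b 1) Z W :=
    fun Z W ↦ g.curvatureForm_antisymm cov x _ _ _ _
  have A32 : ∀ Z W, g.curvatureForm cov x (b 3) (b 2) Z W = -g.curvatureForm cov x (b 2) (b 3) Z W :=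
    fun Z W ↦ g.curvatureForm_antisymm cov x _ _ _ _
  have A20 : ∀ Z W, g.curvatureForm cov x (b 2) (b 0) Z W = -g.curvatureForm cov x (b 0) (b 2) Z W :=
    fun Z W ↦ g.curvatureForm_antisymm cov x _ _ _ _
  have A13 : ∀ Z W, g.curvatureForm cov x (b 1) (b 3) Z W = -g.curvatureForm cov x (b 3) (b 1) Z W :=
    fun Z W ↦ g.curvatureForm_antisymm cov x _ _ _ _
  have A30 : ∀ Z W, g.curvatureForm cov x (b 3) (b 0) Z W = -g.curvatureForm cov x (b 0) (b 3) Z W :=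
    fun Z W ↦ g.curvatureForm_antisymm cov x _ _ _ _
  have A21 : ∀ Z W, g.curvatureForm cov x (b 2) (b 1) Z W = -g.curvatureForm cov x (b 1) (b 2) Z W :=
    fun Z W ↦ g.curvatureForm_antisymm cov x _ _ _ _
  have S01 : ∀ X Y, g.curvatureForm cov x X Y (b 0) (b 1) = -g.curvatureForm cov x X Y (b 1) (b 0) :=
    fun X Y ↦ h.val_curvature_skew hn x _ _ _ _
  have S23 : ∀ X Y, g.curvatureForm cov x X Y (b 2) (b 3) = -g.curvatureForm cov x X Y (b 3) (b 2) :=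
    fun X Y ↦ h.val_curvature_skew hn x _ _ _ _
  have S02 : ∀ X Y, g.curvatureForm cov x X Y (b 0) (b 2) = -g.curvatureForm cov x X Y (b 2) (b 0) :=
    fun X Y ↦ h.val_curvature_skew hn x _ _ _ _
  have S31 : ∀ X Y, g.curvatureForm cov x X Y (b 3) (b 1) = -g.curvatureForm cov x X Y (b 1) (b 3) :=
    fun X Y ↦ h.val_curvature_skew hn x _ _ _ _
  have S03 : ∀ X Y, g.curvatureForm cov x X Y (b 0) (b 3) = -g.curvatureForm cov x X Y (b 3) (b 0) :=
    fun X Y ↦ h.val_curvature_skew hn x _ _ _ _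
  have S12 : ∀ X Y, g.curvatureForm cov x X Y (b 1) (b 2) = -g.curvatureForm cov x X Y (b 2) (b 1) :=
    fun X Y ↦ h.val_curvature_skew hn x _ _ _ _
  have Z : ∀ k Z W, g.curvatureForm cov x (b k) (b k) Z W = 0 := by
    intro k Z W
    have := g.curvatureForm_antisymm cov x (b k) (b k) Z W
    linarith
  rw [Matrix.trace_fin_three, Matrix.trace_fin_three, g.blockA_apply_zero_zero cov x b,
    g.blockA_apply_one_one cov x b, g.blockA_apply_two_two cov x b,
    g.blockC_apply_zero_zero cov x b, blockC_apply_one_one x b, blockC_apply_two_two x b,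
    g.scalarCurvatureWith_eq_sum_of_isOrthonormalFrame b hb cov]
  simp only [bivectorCurvature, Fin.sum_univ_four, Z, A10, A32, A20, A13, A30, A21, S01, S23, S02,
    S31, S03, S12]
  ring

/-- **`tr A = R/2`** in an orthonormal frame (Chen–Zhu 2006, p. 4), from
`trace_blockA_add_trace_blockC` and the Bianchi identity `tr A = tr C`.
[cite: ChenZhu2006, §2, p. 4] -/
theorem trace_blockA_eq_half_scalarCurvature (h : g.IsLeviCivita cov) (hn : 2 ≤ n)
    (b : Module.Basis (Fin 4) ℝ (TangentSpace I x)) (hb : g.IsOrthonormalFrame x b) :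
    (g.blockA cov x b).trace = g.scalarCurvatureWith cov x / 2 := by
  have h1 := trace_blockA_add_trace_blockC x h hn b hb
  have h2 := trace_blockA_eq_trace_blockC h hn x b
  linarith

/-! ### Plücker expansion of `Rm` in the coordinate 2-vectors -/

/-- **Plücker coordinates** of `x ∧ y` in the coordinate 2-vectors `ω` of `basicPairs`:
`(x₀y₁ − x₁y₀, x₂y₃ − x₃y₂, x₀y₂ − x₂y₀, x₃y₁ − x₁y₃, x₀y₃ − x₃y₀, x₁y₂ − x₂y₁)`. [folklore] -/
def plueckerCoords (x y : Fin 4 → ℝ) : Fin 6 → ℝ :=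
  ![x 0 * y 1 - x 1 * y 0, x 2 * y 3 - x 3 * y 2, x 0 * y 2 - x 2 * y 0, x 3 * y 1 - x 1 * y 3,
    x 0 * y 3 - x 3 * y 0, x 1 * y 2 - x 2 * y 1]

/-- `Σ_k |p_k| ≤ 12` for the Plücker coordinates of vectors with coordinates bounded by `1`.
[folklore] -/
theorem sum_abs_plueckerCoords_le {x y : Fin 4 → ℝ} (hx : ∀ a, |x a| ≤ 1) (hy : ∀ a, |y a| ≤ 1) :
    ∑ k, |plueckerCoords x y k| ≤ 12 := by
  have h2 : ∀ a b c d, |x a * y b - x c * y d| ≤ 2 := by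
    intro a b c d
    calc |x a * y b - x c * y d| ≤ |x a * y b| + |x c * y d| := abs_sub _ _
      _ ≤ 1 + 1 := by
          rw [abs_mul, abs_mul]
          gcongr
          · exact (mul_le_one₀ (hx a) (abs_nonneg _) (hy b))
          · exact (mul_le_one₀ (hx c) (abs_nonneg _) (hy d))
      _ = 2 := by norm_num
  simp only [Fin.sum_univ_six, plueckerCoords, Matrix.cons_val_zero, Matrix.cons_val_one,
    Matrix.cons_val]
  linarith [h2 0 1 1 0, h2 2 3 3 2, h2 0 2 2 0, h2 3 1 1 3, h2 0 3 3 0, h2 1 2 2 1]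

omit [FiniteDimensional ℝ E] [CompleteSpace E] in
/-- **Expansion in the first pair**: `Rm(X, Y, Z, W) = Σ_k p_k(X, Y) Rm(ω_k, Z, W)` with `p` the
Plücker coordinates of the coordinates of `X, Y` in a basis `b` (bilinearity and antisymmetry of
`Rm` in its first pair). [folklore] -/
theorem curvatureForm_eq_sum_plueckerCoords₁₂ (b : Module.Basis (Fin 4) ℝ (TangentSpace I x))
    (X Y Z W : TangentSpace I x) :
    g.curvatureForm cov x X Y Z W =
      ∑ k, plueckerCoords (b.repr X) (b.repr Y) k *
        g.curvatureForm cov x (basicPairs b k).1 (basicPairs b k).2 Z W := by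
  have A10 : g.curvatureForm cov x (b 1) (b 0) Z W = -g.curvatureForm cov x (b 0) (b 1) Z W :=
    g.curvatureForm_antisymm cov x _ _ _ _
  have A32 : g.curvatureForm cov x (b 3) (b 2) Z W = -g.curvatureForm cov x (b 2) (b 3) Z W :=
    g.curvatureForm_antisymm cov x _ _ _ _
  have A20 : g.curvatureForm cov x (b 2) (b 0) Z W = -g.curvatureForm cov x (b 0) (b 2) Z W :=
    g.curvatureForm_antisymm cov x _ _ _ _
  have A13 : g.curvatureForm cov x (b 1) (b 3) Z W = -g.curvatureForm cov x (b 3) (b 1) Z W :=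
    g.curvatureForm_antisymm cov x _ _ _ _
  have A30 : g.curvatureForm cov x (b 3) (b 0) Z W = -g.curvatureForm cov x (b 0) (b 3) Z W :=
    g.curvatureForm_antisymm cov x _ _ _ _
  have A21 : g.curvatureForm cov x (b 2) (b 1) Z W = -g.curvatureForm cov x (b 1) (b 2) Z W :=
    g.curvatureForm_antisymm cov x _ _ _ _
  have Zk : ∀ k, g.curvatureForm cov x (b k) (b k) Z W = 0 := by
    intro k
    have := g.curvatureForm_antisymm cov x (b k) (b k) Z W
    linarith
  conv_lhs => rw [← b.sum_repr X, ← b.sum_repr Y]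
  rw [curvatureForm_sum_smul₁]
  simp_rw [curvatureForm_sum_smul₂]
  simp only [Fin.sum_univ_four, Fin.sum_univ_six, plueckerCoords, basicPairs, Matrix.cons_val_zero,
    Matrix.cons_val_one, Matrix.cons_val, Zk, A10, A32, A20, A13, A30, A21]
  ring

/-- **Expansion in the second pair** (for a Levi-Civita connection, antisymmetry of `Rm` in its
second pair): `Rm(X, Y, Z, W) = Σ_l q_l(W, Z) Rm(X, Y, ω_l⁽²⁾, ω_l⁽¹⁾)` with `q` the Plücker
coordinates of `W ∧ Z`. [folklore] -/
theorem curvatureForm_eq_sum_plueckerCoords₃₄ (h : g.IsLeviCivita cov) (hn : 2 ≤ n)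
    (b : Module.Basis (Fin 4) ℝ (TangentSpace I x)) (X Y Z W : TangentSpace I x) :
    g.curvatureForm cov x X Y Z W =
      ∑ l, plueckerCoords (b.repr W) (b.repr Z) l *
        g.curvatureForm cov x X Y (basicPairs b l).2 (basicPairs b l).1 := by
  have S01 : g.curvatureForm cov x X Y (b 0) (b 1) = -g.curvatureForm cov x X Y (b 1) (b 0) :=
    h.val_curvature_skew hn x _ _ _ _
  have S23 : g.curvatureForm cov x X Y (b 2) (b 3) = -g.curvatureForm cov x X Y (b 3) (b 2) :=
    h.val_curvature_skew hn x _ _ _ _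
  have S02 : g.curvatureForm cov x X Y (b 0) (b 2) = -g.curvatureForm cov x X Y (b 2) (b 0) :=
    h.val_curvature_skew hn x _ _ _ _
  have S31 : g.curvatureForm cov x X Y (b 3) (b 1) = -g.curvatureForm cov x X Y (b 1) (b 3) :=
    h.val_curvature_skew hn x _ _ _ _
  have S03 : g.curvatureForm cov x X Y (b 0) (b 3) = -g.curvatureForm cov x X Y (b 3) (b 0) :=
    h.val_curvature_skew hn x _ _ _ _
  have S12 : g.curvatureForm cov x X Y (b 1) (b 2) = -g.curvatureForm cov x X Y (b 2) (b 1) :=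
    h.val_curvature_skew hn x _ _ _ _
  have Zk : ∀ k, g.curvatureForm cov x X Y (b k) (b k) = 0 := by
    intro k
    have := h.val_curvature_skew hn x X Y (b k) (b k)
    change g.curvatureForm cov x X Y (b k) (b k) = -g.curvatureForm cov x X Y (b k) (b k) at this
    linarith
  conv_lhs => rw [← b.sum_repr Z, ← b.sum_repr W]
  rw [curvatureForm_sum_smul₃]
  simp_rw [curvatureForm_sum_smul₄]
  simp only [Fin.sum_univ_four, Fin.sum_univ_six, plueckerCoords, basicPairs, Matrix.cons_val_zero,
    Matrix.cons_val_one, Matrix.cons_val, Zk, S01, S23, S02, S31, S03, S12]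
  ring

/-- **`Rm(X,Y,Z,W) = Σ_{k,l} p_k(X,Y) q_l(W,Z) R(ω_k, ω_l)`**: the curvature tensor of a
Levi-Civita connection is the curvature pairing on the coordinate 2-vectors contracted with
Plücker coordinates. [folklore] -/
theorem curvatureForm_eq_sum_sum_basicCurvatureMatrix (h : g.IsLeviCivita cov) (hn : 2 ≤ n)
    (b : Module.Basis (Fin 4) ℝ (TangentSpace I x)) (X Y Z W : TangentSpace I x) :
    g.curvatureForm cov x X Y Z W =
      ∑ k, ∑ l, plueckerCoords (b.repr X) (b.repr Y) k * plueckerCoords (b.repr W) (b.repr Z) l *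
        g.basicCurvatureMatrix cov x b k l := by
  rw [curvatureForm_eq_sum_plueckerCoords₁₂ x b]
  refine Finset.sum_congr rfl fun k _ ↦ ?_
  rw [curvatureForm_eq_sum_plueckerCoords₃₄ x h hn b, Finset.mul_sum]
  refine Finset.sum_congr rfl fun l _ ↦ ?_
  simp only [basicCurvatureMatrix, Matrix.of_apply, bivectorCurvature]
  ring

/-- **A bound on the coordinate pairings bounds `Rm` on coordinate-bounded vectors**: if
`|R(ω_k, ω_l)| ≤ μ` for the basis `b` and `X, Y, Z, W` have `b`-coordinates of absolute value at
most `1`, then `|Rm(X, Y, Z, W)| ≤ 144 μ`. [folklore] -/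
theorem abs_curvatureForm_le_of_abs_basicCurvatureMatrix_le (h : g.IsLeviCivita cov) (hn : 2 ≤ n)
    (b : Module.Basis (Fin 4) ℝ (TangentSpace I x)) {μ : ℝ}
    (hμ : ∀ k l, |g.basicCurvatureMatrix cov x b k l| ≤ μ) {X Y Z W : TangentSpace I x}
    (hX : ∀ a, |b.repr X a| ≤ 1) (hY : ∀ a, |b.repr Y a| ≤ 1) (hZ : ∀ a, |b.repr Z a| ≤ 1)
    (hW : ∀ a, |b.repr W a| ≤ 1) :
    |g.curvatureForm cov x X Y Z W| ≤ 144 * μ := by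
  have hμ0 : 0 ≤ μ := (abs_nonneg _).trans (hμ 0 0)
  set p := plueckerCoords (b.repr X) (b.repr Y) with hp
  set q := plueckerCoords (b.repr W) (b.repr Z) with hq
  have hp12 : ∑ k, |p k| ≤ 12 := sum_abs_plueckerCoords_le hX hY
  have hq12 : ∑ l, |q l| ≤ 12 := sum_abs_plueckerCoords_le hW hZ
  rw [curvatureForm_eq_sum_sum_basicCurvatureMatrix x h hn b]
  calc |∑ k, ∑ l, p k * q l * g.basicCurvatureMatrix cov x b k l|
      ≤ ∑ k, ∑ l, |p k| * |q l| * μ := by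
        refine (Finset.abs_sum_le_sum_abs _ _).trans (Finset.sum_le_sum fun k _ ↦ ?_)
        refine (Finset.abs_sum_le_sum_abs _ _).trans (Finset.sum_le_sum fun l _ ↦ ?_)
        rw [abs_mul, abs_mul]
        exact mul_le_mul_of_nonneg_left (hμ k l) (by positivity)
    _ = μ * ((∑ k, |p k|) * (∑ l, |q l|)) := by
        rw [Finset.sum_mul_sum]
        rw [Finset.mul_sum]
        refine Finset.sum_congr rfl fun k _ ↦ ?_
        rw [Finset.mul_sum]
        refine Finset.sum_congr rfl fun l _ ↦ ?_
        ring
    _ ≤ μ * (12 * 12) := by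
        refine mul_le_mul_of_nonneg_left ?_ hμ0
        exact mul_le_mul hp12 hq12 (Finset.sum_nonneg fun _ _ ↦ abs_nonneg _) (by norm_num)
    _ = 144 * μ := by ring

omit [CompleteSpace E] in
/-- In a `g_x`-orthonormal basis the coordinates of a vector with `g(X, X) ≤ 1` are at most `1`
in absolute value (`b.repr X a = g(X, b_a)` and Cauchy–Schwarz), for `g` Riemannian.
[folklore] -/
theorem abs_repr_le_one_of_isOrthonormalFrame (hg : g.IsRiemannian)
    (b : Module.Basis (Fin 4) ℝ (TangentSpace I x)) (hb : g.IsOrthonormalFrame x b)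
    {X : TangentSpace I x} (hX : g.val x X X ≤ 1) (a : Fin 4) : |b.repr X a| ≤ 1 := by
  letI := g.riemannianBundle hg
  rw [g.basis_repr_of_isOrthonormalFrame b hb X a]
  have hCS := abs_real_inner_le_norm X (b a)
  rw [g.inner_eq hg x X (b a), g.norm_eq_sqrt hg x X, g.norm_eq_sqrt hg x (b a), hb.1 a,
    Real.sqrt_one, mul_one] at hCS
  exact hCS.trans (Real.sqrt_le_one.2 hX)

end Frame


/-! ### Pinched curvature is bounded in terms of the scalar curvature (dimension four) -/

section Pinched

variable {M : Type*} [TopologicalSpace M] [ChartedSpace (EuclideanSpace ℝ (Fin 4)) M]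
  [IsManifold (𝓡 4) ∞ M] {n : ℕ∞ω}
  {g : PseudoRiemannianMetric (𝓡 4) n (EuclideanSpace ℝ (Fin 4)) (TangentSpace (𝓡 4) : M → Type _)}
  {cov : CovariantDerivative (𝓡 4) (EuclideanSpace ℝ (Fin 4)) (TangentSpace (𝓡 4) : M → Type _)}

/-- **Under the pinching assumption the whole curvature tensor is bounded by the scalar
curvature** (Chen–Zhu 2006, §5, p. 26, pinching assumption (5.1)–(5.2), as used throughout
§§4–5 — e.g. p. 24, "the set of all points where curvature stays bounded", and p. 19, where
bounded scalar curvature is traded for bounded curvature in the rescaling arguments; Hamilton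
1997, §2, Cors. 1.5 and 1.8: "all curvature eigenvalues are bounded by multiples of `a₁ + ρ`").
If `g` is Riemannian on a smooth 4-manifold, `cov` a Levi-Civita connection of `g`, and at the
point `x` the blocks `(A, B, C)` of every `g`-orthonormal frame satisfy
`Matrix.PinchedBy A B C ρ Λ` (`ρ, Λ ≥ 0`) while `R(x) ≤ K`, then
`|Rm_x(X, Y, Z, W)| ≤ 288 (Λ (K/6 + ρ) + ρ)` for all `g`-unit-bounded `X, Y, Z, W`.
*Proof.* In an orthonormal basis `tr A = R/2 ≤ K/2` (`trace_blockA_eq_half_scalarCurvature`), so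
the entries of `A, B, C` are at most `2(Λ(K/6 + ρ) + ρ)` (`Matrix.PinchedBy.abs_apply_le`), hence
so are the pairings `R(ω_k, ω_l)` (`Rω = ¼ ᵗQ M Q`), and `Rm` is their contraction with Plücker
coordinates of total weight `≤ 12 · 12`.
[cite: ChenZhu2006, §5, p. 26, (5.1)–(5.2)] [cite: Hamilton1997, §2, Cor. 1.5 and Cor. 1.8] -/
theorem abs_curvatureForm_le_of_pinchedBy (hg : g.IsRiemannian) (h : g.IsLeviCivita cov)
    (hn : 2 ≤ n) (x : M) {ρ Λ K : ℝ} (hρ : 0 ≤ ρ) (hΛ : 0 ≤ Λ)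
    (hpinch : ∀ e : Fin 4 → TangentSpace (𝓡 4) x, g.IsOrthonormalFrame x e →
      Matrix.PinchedBy (g.blockA cov x e) (g.blockB cov x e) (g.blockC cov x e) ρ Λ)
    (hR : g.scalarCurvatureWith cov x ≤ K) {X Y Z W : TangentSpace (𝓡 4) x}
    (hX : g.val x X X ≤ 1) (hY : g.val x Y Y ≤ 1) (hZ : g.val x Z Z ≤ 1) (hW : g.val x W W ≤ 1) :
    |g.curvatureForm cov x X Y Z W| ≤ 288 * (Λ * (K / 6 + ρ) + ρ) := by
  obtain ⟨b, hb⟩ := g.exists_basis_isOrthonormalFrame (x := x) (hg x) finrank_euclideanSpace_fin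
  have hP := hpinch b hb
  have hAs := blockA_isSymm h hn x b
  have hCs := blockC_isSymm h hn x b
  have htr : (g.blockA cov x b).trace ≤ K / 2 := by
    rw [trace_blockA_eq_half_scalarCurvature x h hn b hb]
    linarith
  have hent := fun i j ↦ hP.abs_apply_le hρ hΛ hAs hCs htr i j
  have hM : ∀ i j, |g.blockSix cov x b i j| ≤ 2 * (Λ * (K / 6 + ρ) + ρ) :=
    abs_blockSix_le x b h hn (fun i j ↦ (hent i j).1) (fun i j ↦ (hent i j).2.1)
      (fun i j ↦ (hent i j).2.2)
  have hRω := abs_basicCurvatureMatrix_le x (⇑b) h hn hM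
  have hb1 := fun (V : TangentSpace (𝓡 4) x) (hV : g.val x V V ≤ 1) (a : Fin 4) ↦
    abs_repr_le_one_of_isOrthonormalFrame x hg b hb hV a
  have hfin := abs_curvatureForm_le_of_abs_basicCurvatureMatrix_le x h hn b hRω (hb1 X hX)
    (hb1 Y hY) (hb1 Z hZ) (hb1 W hW)
  linarith

/-- The same bound in the vocabulary of `CanonicalNeighbourhoods.lean`: under the pinching
assumption at every point, the curvature is bounded on `{x | R(x) ≤ K}` by
`288 (Λ (K/6 + ρ) + ρ)` (`CurvatureBoundedOn`). [cite: ChenZhu2006, §5, p. 26, (5.1)–(5.2)] -/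
theorem curvatureBoundedOn_setOf_scalarCurvature_le_of_pinchedBy (hg : g.IsRiemannian)
    (h : g.IsLeviCivita cov) (hn : 2 ≤ n) {ρ Λ : ℝ} (hρ : 0 ≤ ρ) (hΛ : 0 ≤ Λ)
    (hpinch : ∀ (x : M) (e : Fin 4 → TangentSpace (𝓡 4) x), g.IsOrthonormalFrame x e →
      Matrix.PinchedBy (g.blockA cov x e) (g.blockB cov x e) (g.blockC cov x e) ρ Λ) (K : ℝ) :
    CurvatureBoundedOn g cov {x | g.scalarCurvatureWith cov x ≤ K} (288 * (Λ * (K / 6 + ρ) + ρ)) :=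
  fun x hx _ _ _ _ hX hY hZ hW ↦
    abs_curvatureForm_le_of_pinchedBy hg h hn x hρ hΛ (hpinch x) hx hX hY hZ hW

end Pinched

/-! ### Stages satisfying the a priori assumptions -/

section Stage

variable {M : Type} [TopologicalSpace M] [T2Space M] [CompactSpace M]
  [ChartedSpace (EuclideanSpace ℝ (Fin 4)) M] [IsManifold (𝓡 4) ∞ M] [MeasurableSpace M]
  [BorelSpace M] {𝔭 : ChenZhuAPrioriParams}
  {g : ℝ → PseudoRiemannianMetric (𝓡 4) ∞ (EuclideanSpace ℝ (Fin 4)) (TangentSpace (𝓡 4) : M → Type _)}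
  {cov : ℝ → CovariantDerivative (𝓡 4) (EuclideanSpace ℝ (Fin 4)) (TangentSpace (𝓡 4) : M → Type _)}
  {T t₀ : ℝ}

/-- **For a stage satisfying the a priori assumptions, bounded scalar curvature means bounded
curvature** (Chen–Zhu 2006, §5, p. 26, the pinching assumption (5.1)–(5.2); used on p. 24 for
"the set of all points where curvature stays bounded" and in every rescaling argument of
§§4–5): along a Ricci flow of Riemannian metrics `(g, cov)` on `[0, T)` satisfying
`ChenZhuAPriori 𝔭 g cov T t₀` (`ρ, Λ ≥ 0`), at every time `t ∈ [0, T)` the curvature is bounded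
by `288 (Λ (K/6 + ρ) + ρ)` on `{x | R(x, t) ≤ K}`. [cite: ChenZhu2006, §5, p. 26, (5.1)–(5.2)] -/
theorem ChenZhuAPriori.curvatureBoundedOn_setOf_scalarCurvature_le
    (hA : ChenZhuAPriori 𝔭 g cov T t₀) (hflow : IsRicciFlow g cov (Ico 0 T))
    (hRiem : ∀ t ∈ Ico 0 T, (g t).IsRiemannian) (hρ : 0 ≤ 𝔭.ρ) (hΛ : 0 ≤ 𝔭.Λ) {t : ℝ}
    (ht : t ∈ Ico 0 T) (K : ℝ) :
    CurvatureBoundedOn (g t) (cov t) {x | (g t).scalarCurvatureWith (cov t) x ≤ K}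
      (288 * (𝔭.Λ * (K / 6 + 𝔭.ρ) + 𝔭.ρ)) := by
  have hn : (2 : ℕ∞ω) ≤ ((⊤ : ℕ∞) : ℕ∞ω) := WithTop.coe_le_coe.mpr le_top
  exact curvatureBoundedOn_setOf_scalarCurvature_le_of_pinchedBy (hRiem t ht)
    (hflow.isLeviCivita t ht) hn hρ hΛ (fun x e he ↦ (hA.pinching t ht x e he).1) K

/-- Pointwise form of `ChenZhuAPriori.curvatureBoundedOn_setOf_scalarCurvature_le`.
[cite: ChenZhu2006, §5, p. 26, (5.1)–(5.2)] -/
theorem ChenZhuAPriori.abs_curvatureForm_le (hA : ChenZhuAPriori 𝔭 g cov T t₀)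
    (hflow : IsRicciFlow g cov (Ico 0 T)) (hRiem : ∀ t ∈ Ico 0 T, (g t).IsRiemannian)
    (hρ : 0 ≤ 𝔭.ρ) (hΛ : 0 ≤ 𝔭.Λ) {t : ℝ} (ht : t ∈ Ico 0 T) (x : M) {K : ℝ}
    (hR : (g t).scalarCurvatureWith (cov t) x ≤ K) {X Y Z W : TangentSpace (𝓡 4) x}
    (hX : (g t).val x X X ≤ 1) (hY : (g t).val x Y Y ≤ 1) (hZ : (g t).val x Z Z ≤ 1)
    (hW : (g t).val x W W ≤ 1) :
    |(g t).curvatureForm (cov t) x X Y Z W| ≤ 288 * (𝔭.Λ * (K / 6 + 𝔭.ρ) + 𝔭.ρ) :=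
  hA.curvatureBoundedOn_setOf_scalarCurvature_le hflow hRiem hρ hΛ ht K x hR X Y Z W hX hY hZ hW

end Stage

end Literature.Geometry.Riemannian

end
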